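import Mathlib
import Summits.MatrixMultiplication.MatrixMultiplication.Theorems.HiddenToeplitzCornersHiddenCornerLemmaRBlockToeplitzPair

/-!
# Block-Toeplitz slot configurations II: the block-Toeplitz slot lemma

Support file for crux item `stmt-MatrixMultiplication-10752`
(`Summit.MatrixMultiplication.MatrixMultiplication.Theses.HiddenToeplitzCorners.HiddenCornerLemmaR`),
line `atkinson-lloyd-core-split`, stub `stub_mixedDeepBound` (mixed compression classes).

`hclR_blockToeplitz_slot`: let `blk : Fin N → Fin B` be a MONOTONE labelling of the columns (so
every label class is an interval of columns, a "block") and let `T 0, …, T (B+1)` be `N × N`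
matrices that are Toeplitz inside every column block (`T b i j = T b i' j'` whenever
`blk j = blk j'` and `i + j' = i' + j`).  If `E 0, …, E (B+1)` are arbitrary vectors and
`T b *ᵥ E c = [b = c] • f` for all `b, c`, then `f = 0`.  With one block this is the honest
Toeplitz three-slot lemma `hclR_toeplitz_three_slot`; block-Toeplitz matrices with `B` blocks
are exactly the matrices whose Stein displacement `M − Z M Zᵀ` is supported on row `0` and
`B − 1` interior cut columns, i.e. the coefficient matrices of the mixed compression class
`(p,q) = (1, ·)` whose left generator sits on row `0` and whose right generators are unit vectors
(see `HiddenCornerLemmaRStubMixedDeepBound`, `hclR_mixed_row0_cuts_bound`: `r ≤ #cuts + 2`).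

Proof: the short-syzygy argument of the three-slot lemma run with SIMULTANEOUS syzygies of the
`B` shifted reversed block polynomials `Ẽ_c^v` of the frame (block `v` of width `n_v`, offset
`o v = #{j : blk j ≤ v}`, so `deg Ẽ_c^v < n_v`).  (A) `hclR_blk_orth`: a simultaneous syzygy `P`
of degree `≤ μ` makes the coefficients of `P_b φ` vanish in degrees `[μ, N)` (`φ` the reversed
target).  (B) A nonzero simultaneous syzygy of degree `≤ m := (N − B)/2` exists by counting:
`(B+2)(m+1)` unknowns against `∑_v (n_v + m) = N + B m` equations.  (C) For `μ` minimal,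
`2μ ≤ N`, the truncations `ρ_b = P_b φ mod X^N` satisfy `P_c ρ_b = P_b ρ_c`, so `ρ` is a
simultaneous syzygy of degree `< μ`, hence `0`: `X^N ∣ P_b φ`.  (D) With `φ = X^v u`, `X ∤ u`,
`v < N`: `X^(N−v) ∣ P_b` for all `b`, and `P / X^(N−v)` is a smaller nonzero simultaneous
syzygy — contradiction, so `φ = 0`.  Nothing beyond Mathlib and part I.
-/

set_option linter.dupNamespace false

namespace Summit.MatrixMultiplication.MatrixMultiplication.Theorems

open Polynomial Matrix BigOperators Finset

/-- **Block-Toeplitz slot lemma.**  Let `blk : Fin N → Fin B` be a monotone labelling of the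
columns (so each label class is an interval of columns, a "block"), and let
`T 0, …, T (B+1)` be `N × N` matrices that are Toeplitz inside every column block
(`T b i j = T b i' j'` whenever `j`, `j'` carry the same label and `i + j' = i' + j`).  If
`E 0, …, E (B+1)` are arbitrary vectors and `T b *ᵥ E c = [b = c] • f` for all `b, c`, then `f = 0`.
(`B = 1`, one block: the honest-Toeplitz three-slot lemma `hclR_toeplitz_three_slot`.)

Proof: the short-syzygy argument of the three-slot lemma, run with SIMULTANEOUS syzygies of the
`B` reversed block polynomials of the frame.  (A) a simultaneous syzygy `P` of degree `≤ μ` is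
orthogonal, with all its shifts, to the targets: the coefficients of `P_b · φ` (`φ` the reversed
target polynomial) vanish in degrees `[μ, N)`; (B) a nonzero simultaneous syzygy of degree
`≤ m := (N - B) / 2` exists by counting (`(B+2)(m+1)` unknowns against `N + B m` equations — block
`v` of width `n_v` contributes `n_v + m`); (C)/(D) with `μ` minimal, `2μ ≤ N` makes the truncations
`P_b φ mod X^N` a syzygy of degree `< μ`, hence zero, so `X^N ∣ P_b φ`, and then `X^(N-v(φ))`
divides every `P_b`, contradicting minimality unless `φ = 0`. -/
theorem hclR_blockToeplitz_slot :
    ∀ (N B : ℕ) (blk : Fin N → Fin B), (∀ j j' : Fin N, j ≤ j' → blk j ≤ blk j') →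
    ∀ (T : Fin (B + 2) → Matrix (Fin N) (Fin N) ℂ),
      (∀ b, ∀ i j i' j' : Fin N, blk j = blk j' → (i : ℕ) + j' = i' + j → T b i j = T b i' j') →
      ∀ (E : Fin (B + 2) → Fin N → ℂ) (f : Fin N → ℂ),
        (∀ b c, T b *ᵥ E c = if b = c then f else 0) → f = 0 := by
  intro N B blk hmono T hT E f hcorner
  classical
  rcases Nat.eq_zero_or_pos N with hN | hN
  · subst hN; funext i; exact Fin.elim0 i
  by_contra hf
  -- block bookkeeping: `o v` = number of columns labelled `≤ v`, `n v` = width of block `v`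
  let o : Fin B → ℕ := fun v => (Finset.univ.filter fun j : Fin N => blk j ≤ v).card
  let o' : Fin B → ℕ := fun v => (Finset.univ.filter fun j : Fin N => blk j < v).card
  let n : Fin B → ℕ := fun v => (Finset.univ.filter fun j : Fin N => blk j = v).card
  have ho_split : ∀ v, o v = o' v + n v := by
    intro v
    have hu : (Finset.univ.filter fun j : Fin N => blk j ≤ v) =
        (Finset.univ.filter fun j : Fin N => blk j < v) ∪
          (Finset.univ.filter fun j : Fin N => blk j = v) := by
      ext j; simp [le_iff_lt_or_eq]
    have hd : Disjoint (Finset.univ.filter fun j : Fin N => blk j < v)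
        (Finset.univ.filter fun j : Fin N => blk j = v) := by
      rw [Finset.disjoint_filter]; intro j _ h1 h2; exact absurd h2 (ne_of_lt h1)
    show (Finset.univ.filter fun j : Fin N => blk j ≤ v).card = _
    rw [hu, Finset.card_union_of_disjoint hd]
  have ho_lt : ∀ m : Fin N, (m : ℕ) < o (blk m) := by
    intro m
    have hsub : Finset.Iic m ⊆ (Finset.univ.filter fun j : Fin N => blk j ≤ blk m) := by
      intro j hj
      rw [Finset.mem_Iic] at hj
      simp [hmono j m hj]
    have := Finset.card_le_card hsub
    rw [Fin.card_Iic] at this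
    exact this
  have ho'_le : ∀ m : Fin N, o' (blk m) ≤ (m : ℕ) := by
    intro m
    have hsub : (Finset.univ.filter fun j : Fin N => blk j < blk m) ⊆ Finset.Iio m := by
      intro j hj
      simp only [Finset.mem_filter, Finset.mem_univ, true_and] at hj
      rw [Finset.mem_Iio]
      by_contra hle
      push Not at hle
      exact absurd (hmono m j hle) (not_le.mpr hj)
    have := Finset.card_le_card hsub
    rw [Fin.card_Iio] at this
    exact this
  have hn_sum : ∑ v : Fin B, n v = N := by
    have h := Finset.card_eq_sum_card_fiberwise (s := (Finset.univ : Finset (Fin N)))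
      (t := (Finset.univ : Finset (Fin B))) (f := blk) (fun _ _ => Finset.mem_univ _)
    rw [Finset.card_univ, Fintype.card_fin] at h
    exact h.symm
  -- reversed, shifted block polynomials of the frame and the reversed target polynomial
  set Er : Fin (B + 2) → Fin B → ℂ[X] := fun c v =>
    ∑ m : Fin N, if blk m = v then C (E c m) * X ^ (o v - 1 - (m : ℕ)) else 0 with hEr
  set φ : ℂ[X] := ∑ n : Fin N, C (f n) * X ^ (N - 1 - (n : ℕ)) with hφ
  have hEr_coeff : ∀ c v k, n v ≤ k → (Er c v).coeff k = 0 := by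
    intro c v k hk
    rw [hEr]
    simp only [finsetSum_coeff]
    refine Finset.sum_eq_zero fun m _ => ?_
    by_cases hm : blk m = v
    · rw [if_pos hm, coeff_C_mul_X_pow, if_neg]
      have h1 := ho'_le m; have h2 := ho_split v
      have h3 : 0 < n v := Finset.card_pos.mpr ⟨m, by simp [hm]⟩
      rw [hm] at h1
      omega
    · rw [if_neg hm, coeff_zero]
  have hEr_deg : ∀ c v, Er c v ≠ 0 → (Er c v).natDegree < n v := by
    intro c v hz
    by_contra h
    push Not at h
    have := hEr_coeff c v _ h
    rw [coeff_natDegree, leadingCoeff_eq_zero] at this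
    exact hz this
  have hφ_deg : φ.natDegree ≤ N - 1 :=
    natDegree_sum_le_of_forall_le _ _ fun m _ => (natDegree_C_mul_X_pow_le _ _).trans (by omega)
  have hφ_coeff : ∀ n : Fin N, φ.coeff (N - 1 - n) = f n := by
    intro n
    rw [hφ, finsetSum_coeff]
    simp only [coeff_C_mul_X_pow]
    rw [Finset.sum_eq_single n]
    · simp
    · intro b _ hb
      rw [if_neg]
      exact fun h => hb (Fin.ext (by have := b.is_lt; have := n.is_lt; omega))
    · simp
  have hφ0 : φ ≠ 0 := by
    intro h
    apply hf
    funext n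
    have := hφ_coeff n
    rw [h, coeff_zero] at this
    exact this.symm
  -- simultaneous syzygies of the block polynomials
  let Syz : (Fin (B + 2) → ℂ[X]) → Prop := fun P => ∀ v : Fin B, ∑ c, P c * Er c v = 0
  -- (A) orthogonality: coefficients of `P b * φ` vanish in degrees `[μ, N)` (`hclR_blk_orth`)
  have horth : ∀ (P : Fin (B + 2) → ℂ[X]) (μ : ℕ), Syz P → (∀ c, (P c).natDegree ≤ μ) →
      ∀ b, ∀ K, μ ≤ K → K < N → (P b * φ).coeff K = 0 :=
    fun P μ hP hdeg b K hμK hKN =>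
      hclR_blk_orth N B (B + 2) blk o ho_lt T hT E f hcorner P μ hP hdeg b K hμK hKN
  -- (B) a nonzero simultaneous syzygy of degree ≤ m := (N - B) / 2 exists (dimension count)
  set m := (N - B) / 2 with hm
  have hexist : ∃ P : Fin (B + 2) → ℂ[X], Syz P ∧ P ≠ 0 ∧ ∀ c, (P c).natDegree ≤ m := by
    let vfam : Fin (B + 2) × Fin (m + 1) → ((v : Fin B) → Fin (n v + m) → ℂ) :=
      fun ca v k => (X ^ (ca.2 : ℕ) * Er ca.1 v).coeff k
    have hli : ¬ LinearIndependent ℂ vfam := by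
      intro hli
      have h1 := hli.fintype_card_le_finrank
      rw [Module.finrank_pi_fintype, Fintype.card_prod, Fintype.card_fin, Fintype.card_fin] at h1
      simp only [Module.finrank_fin_fun] at h1
      rw [Finset.sum_add_distrib, hn_sum, Finset.sum_const, Finset.card_univ, Fintype.card_fin,
        smul_eq_mul] at h1
      have e1 : (B + 2) * (m + 1) = B * m + (B + 2 * m + 2) := by ring
      rw [e1] at h1
      omega
    obtain ⟨g, hg, ⟨c₀, a₀⟩, hg0⟩ := Fintype.not_linearIndependent_iff.mp hli
    refine ⟨fun c => ∑ a : Fin (m + 1), C (g (c, a)) * X ^ (a : ℕ), ?_, ?_, ?_⟩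
    · intro v
      show ∑ c, (∑ a : Fin (m + 1), C (g (c, a)) * X ^ (a : ℕ)) * Er c v = 0
      ext k
      rw [finsetSum_coeff, coeff_zero]
      by_cases hk : k < n v + m
      · have h1 := congr_fun (congr_fun hg v) ⟨k, hk⟩
        simp only [Finset.sum_apply, Pi.smul_apply, smul_eq_mul, Pi.zero_apply] at h1
        rw [Fintype.sum_prod_type] at h1
        refine Eq.trans ?_ h1
        refine Finset.sum_congr rfl fun c _ => ?_
        rw [Finset.sum_mul, finsetSum_coeff]
        refine Finset.sum_congr rfl fun a _ => ?_
        rw [mul_assoc, coeff_C_mul]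
      · refine Finset.sum_eq_zero fun c _ => ?_
        by_cases hz : Er c v = 0
        · rw [hz, mul_zero, coeff_zero]
        apply coeff_eq_zero_of_natDegree_lt
        calc ((∑ a : Fin (m + 1), C (g (c, a)) * X ^ (a : ℕ)) * Er c v).natDegree
            ≤ (∑ a : Fin (m + 1), C (g (c, a)) * X ^ (a : ℕ)).natDegree + (Er c v).natDegree :=
              natDegree_mul_le
          _ < k := by
              have h1 : (∑ a : Fin (m + 1), C (g (c, a)) * X ^ (a : ℕ)).natDegree ≤ m :=
                natDegree_sum_le_of_forall_le _ _ fun a _ =>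
                  (natDegree_C_mul_X_pow_le _ _).trans (by omega)
              have h2 := hEr_deg c v hz
              omega
    · intro hP
      apply hg0
      have h1 : (∑ a : Fin (m + 1), C (g (c₀, a)) * X ^ (a : ℕ)) = 0 := congr_fun hP c₀
      have hc := congrArg (fun p : ℂ[X] => p.coeff a₀) h1
      simp only [finsetSum_coeff, coeff_C_mul_X_pow, coeff_zero] at hc
      rw [Finset.sum_eq_single a₀] at hc
      · simpa using hc
      · intro a _ ha
        rw [if_neg]
        exact fun h => ha (Fin.ext (by omega))
      · simp
    · intro c
      exact natDegree_sum_le_of_forall_le _ _ fun a _ =>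
        (natDegree_C_mul_X_pow_le _ _).trans (by omega)
  -- minimal degree `μ` of a nonzero simultaneous syzygy
  let Pred : ℕ → Prop := fun μ => ∃ P : Fin (B + 2) → ℂ[X], Syz P ∧ P ≠ 0 ∧ ∀ c, (P c).natDegree ≤ μ
  have hPred : ∃ μ, Pred μ := ⟨m, hexist⟩
  obtain ⟨P, hPsyz, hP0, hPdeg⟩ : Pred (Nat.find hPred) := Nat.find_spec hPred
  set μ := Nat.find hPred with hμdef
  have hμm : μ ≤ m := Nat.find_min' hPred hexist
  have hmin : ∀ Q : Fin (B + 2) → ℂ[X], Syz Q → (∀ c, Q c ≠ 0 → (Q c).natDegree < μ) → Q = 0 := by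
    intro Q hQ hQdeg
    by_contra hQ0
    obtain ⟨c₁, hc₁⟩ : ∃ c, Q c ≠ 0 := by
      by_contra hall; push Not at hall; exact hQ0 (funext hall)
    have hμpos : 0 < μ := by have := hQdeg c₁ hc₁; omega
    have hP' : Pred (μ - 1) := ⟨Q, hQ, hQ0, fun c => by
      by_cases h : Q c = 0
      · rw [h, natDegree_zero]; exact Nat.zero_le _
      · have := hQdeg c h; omega⟩
    exact Nat.find_min hPred (show μ - 1 < μ by omega) hP'
  have h2μ : 2 * μ ≤ N := by omega
  -- (C) truncations `ρ b := (P b * φ) mod X^N` have degree `< μ`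
  have hXN : (X ^ N : ℂ[X]).Monic := monic_X_pow N
  have hdiv : ∀ b, ∃ ρb σb : ℂ[X], P b * φ = ρb + X ^ N * σb ∧ ρb.degree < N := fun b =>
    ⟨(P b * φ) %ₘ X ^ N, (P b * φ) /ₘ X ^ N, (modByMonic_add_div (P b * φ) (X ^ N)).symm,
      (degree_modByMonic_lt _ hXN).trans_eq (degree_X_pow N)⟩
  choose ρ σ hρσ hρN using hdiv
  have hρcoeff : ∀ b K, μ ≤ K → (ρ b).coeff K = 0 := by
    intro b K hK
    rcases lt_or_ge K N with hKN | hKN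
    · have e : (ρ b).coeff K = (P b * φ).coeff K - (X ^ N * σ b).coeff K := by
        rw [hρσ b, coeff_add]; ring
      rw [e, horth P μ hPsyz hPdeg b K hK hKN, coeff_X_pow_mul', if_neg (by omega), sub_zero]
    · apply coeff_eq_zero_of_degree_lt
      calc (ρ b).degree < N := hρN b
        _ ≤ K := by exact_mod_cast hKN
  have hρdeg : ∀ b, ρ b ≠ 0 → (ρ b).natDegree < μ := by
    intro b hb
    by_contra h
    push Not at h
    have := hρcoeff b _ h
    rw [coeff_natDegree, leadingCoeff_eq_zero] at this
    exact hb this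
  -- cross relation `P c * ρ b = P b * ρ c`
  have hcross : ∀ b c, P c * ρ b = P b * ρ c := by
    intro b c
    have hdvd : (X ^ N : ℂ[X]) ∣ (P c * ρ b - P b * ρ c) := by
      refine ⟨P b * σ c - P c * σ b, ?_⟩
      have eb := hρσ b
      have ec := hρσ c
      linear_combination (P b) * ec - (P c) * eb
    have h1 : ∀ b c, (P c * ρ b).natDegree < N := by
      intro b c
      by_cases hb : ρ b = 0
      · rw [hb, mul_zero, natDegree_zero]; exact hN
      · calc (P c * ρ b).natDegree ≤ (P c).natDegree + (ρ b).natDegree := natDegree_mul_le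
          _ < N := by have := hPdeg c; have := hρdeg b hb; omega
    have hdeg : (P c * ρ b - P b * ρ c).natDegree < (X ^ N : ℂ[X]).natDegree := by
      rw [natDegree_X_pow]
      calc (P c * ρ b - P b * ρ c).natDegree
          ≤ max (P c * ρ b).natDegree (P b * ρ c).natDegree := natDegree_sub_le _ _
        _ < N := max_lt (h1 b c) (h1 c b)
    exact sub_eq_zero.mp (eq_zero_of_dvd_of_natDegree_lt hdvd hdeg)
  -- `ρ` is a simultaneous syzygy of degree `< μ`, hence zero
  obtain ⟨b₀, hb₀⟩ : ∃ b, P b ≠ 0 := by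
    by_contra hall; push Not at hall; exact hP0 (funext hall)
  have hρsyz : Syz ρ := by
    intro v
    show ∑ c, ρ c * Er c v = 0
    have h1 : P b₀ * ∑ c, ρ c * Er c v = ρ b₀ * ∑ c, P c * Er c v := by
      rw [Finset.mul_sum, Finset.mul_sum]
      refine Finset.sum_congr rfl fun c _ => ?_
      rw [← mul_assoc, ← mul_assoc, hcross c b₀, mul_comm (P c)]
    rw [hPsyz v, mul_zero] at h1
    exact (mul_eq_zero.mp h1).resolve_left hb₀
  have hρ0 : ρ = 0 := hmin ρ hρsyz fun c hc => hρdeg c hc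
  have hdvdN : ∀ b, (X ^ N : ℂ[X]) ∣ P b * φ := by
    intro b
    refine ⟨σ b, ?_⟩
    have h1 := hρσ b
    rw [show ρ b = 0 from congr_fun hρ0 b, zero_add] at h1
    exact h1
  -- (D) valuation of `φ`: `φ = X^v * u`, `X ∤ u`, `v < N`
  obtain ⟨u, hu, hXu⟩ := exists_eq_pow_rootMultiplicity_mul_and_not_dvd φ hφ0 0
  rw [map_zero, sub_zero] at hu hXu
  set w := rootMultiplicity 0 φ with hw
  have hwN : w < N := by
    have h1 : (X ^ w : ℂ[X]) ∣ φ := ⟨u, hu⟩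
    have h2 := natDegree_le_of_dvd h1 hφ0
    rw [natDegree_X_pow] at h2
    omega
  have hcop : IsCoprime ((X : ℂ[X]) ^ (N - w)) u :=
    ((irreducible_X.coprime_iff_not_dvd).mpr hXu).pow_left
  have hdvdP : ∀ b, ∃ Qb : ℂ[X], P b = X ^ (N - w) * Qb := by
    intro b
    apply hcop.dvd_of_dvd_mul_right
    have h := hdvdN b
    rw [hu, ← mul_assoc, mul_comm (P b), mul_assoc,
      show (X ^ N : ℂ[X]) = X ^ w * X ^ (N - w) by rw [← pow_add]; congr 1; omega] at h
    exact (mul_dvd_mul_iff_left (pow_ne_zero w X_ne_zero)).mp h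
  choose Q hQ using hdvdP
  have hQsyz : Syz Q := by
    intro v
    show ∑ c, Q c * Er c v = 0
    have h1 : (X : ℂ[X]) ^ (N - w) * ∑ c, Q c * Er c v = ∑ c, P c * Er c v := by
      rw [Finset.mul_sum]
      refine Finset.sum_congr rfl fun c _ => ?_
      rw [← mul_assoc, ← hQ c]
    rw [hPsyz v] at h1
    exact (mul_eq_zero.mp h1).resolve_left (pow_ne_zero _ X_ne_zero)
  have hQ0 : Q = 0 := hmin Q hQsyz fun c hc => by
    have h1 : (P c).natDegree = (N - w) + (Q c).natDegree := by
      rw [hQ c, natDegree_mul (pow_ne_zero _ X_ne_zero) hc, natDegree_X_pow]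
    have := hPdeg c
    omega
  apply hP0
  funext c
  rw [hQ c, show Q c = 0 from congr_fun hQ0 c, mul_zero]
  rfl

end Summit.MatrixMultiplication.MatrixMultiplication.Theorems
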